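import Summits.ValiantsHypothesis.ValiantsHypothesis.Theorems.KPlusLogSqLawTropicalBThreeFiveExact04112130

/-!
# Route «KPlusLogSqLaw», crux `TropicalB` (stmt-ValiantsHypothesis-19771) — `(3,5)` row: `T_D(3,5; d) ≤ 31` on a whole EXPONENT CELL
# (every strictly increasing `d` satisfying the listed slope comparisons; the cell of `(0, 4, 11, 21, 30)`), — the symbolic form of `…ThreeFiveExact04112130`, same five-pattern family

HONEST FRAMING.  Helper toward the registered stubs `stub_tropThin` / `stub_tropFat` of `Cruxes/TropicalB/Lines/birth.lean` (crux `TropicalB`,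
item stmt-ValiantsHypothesis-19771; cell `pub-symmetroid`, seat val-sym-trop-p3 g10, 2026-08-28; `--supports … --as helper`).  A census bound for the
small format `(3,5)` on an open polyhedral cone of exponent vectors — the SYMBOLIC form of `…ThreeFiveExact04112130` (concrete `d`) and the template
of the leaves of the kernel programme «TropRowD 3 5 31» (memo HOME/val-sym-trop-p3/g10/FINDINGS §5): a decision tree over slope comparisons whose
leaves are exactly theorems of this shape.  Nothing here bears on `TropicalB` in its window, `WeakLifting`, DoorA26 / DoorA34, `MatrixDescartes`
(stmt-ValiantsHypothesis-18050) or VP ≠ VNP.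

THEOREM `designRowD_le_31_cellA` : for every strictly increasing `d : Fin 5 → ℕ` with the listed strict relations between sums of
exponents (pair sums, triple sums = histogram slopes, and sums of two triples; all hold at `d = (0, 4, 11, 21, 30)`), every dominance design with exponents
`d` has unsigned dominant chains of at most `31` breakpoints.  PROOF: `ThreeFive.leD_31_of_family` with the family `family04112130` of `…ThreeFiveExact04112130` (its five kernel-decided pattern refutations,
arrangement and covering lemmas are reused by name); only the relation lists of the entries and the slope order of the patterns are discharged here,
from the 17 hypotheses, by `omega`.  The hypotheses are the comparisons the certificates use, common terms cancelled and monotone consequences dropped;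
they all hold at `d = (0,4,11,21,30)` (so the concrete theorem is the special case) and define an open polyhedral cone of exponent vectors.  [this cell]
-/

set_option linter.dupNamespace false
set_option autoImplicit false

namespace Summit.ValiantsHypothesis.ValiantsHypothesis.Theorems.KPlusLogSqLaw

open Summit.ValiantsHypothesis.ValiantsHypothesis.Theorems.MatrixDescartes.Negative
open Summit.ValiantsHypothesis.ValiantsHypothesis.Theorems.LacunarySymmetroidMatrixDescartes.TropicalCensus
open Finset ForbiddenPatterns

namespace ThreeFive

/-- **`T_D(3,5; d) ≤ 31` ON THE CELL**: for strictly increasing `d` with the listed relations, every unsigned dominant chain of every design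
with exponents `d` has at most `31` breakpoints. [this cell] -/
theorem designRowD_le_31_cellA (d : Fin 5 → ℕ) (hd : StrictMono d)
    (h0 : d 1 + d 1 < d 0 + d 2) (h1 : d 1 + d 1 < d 0 + d 3) (h2 : d 2 + d 2 < d 1 + d 3) (h3 : d 1 + d 2 < d 0 + d 3) (h4 : d 0 + d 3 < d 2 + d 2) (h5 : d 2 + d 2 + d 2 < d 1 + d 1 + d 4) (h6 : d 2 + d 2 < d 1 + d 4) (h7 : d 2 + d 3 < d 1 + d 4) (h8 : d 2 + d 4 < d 3 + d 3) (h9 : d 1 + d 1 + d 4 < d 0 + d 3 + d 3) (h10 : d 0 + d 4 < d 2 + d 3) (h11 : d 1 + d 1 + d 3 < d 0 + d 0 + d 4) (h12 : d 1 + d 2 < d 0 + d 4) (h13 : d 0 + d 0 + d 4 < d 2 + d 2 + d 2) (h14 : d 0 + d 4 < d 3 + d 3) (h15 : d 1 + d 3 < d 0 + d 4) (h16 : d 1 + d 4 < d 3 + d 3)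
    (v ε : Fin 3 → Fin 3 → Fin 5 → ℤ) : DesignRowD d v ε 31 := by
  have m01 : d 0 < d 1 := hd (by decide)
  have m12 : d 1 < d 2 := hd (by decide)
  have m23 : d 2 < d 3 := hd (by decide)
  have m34 : d 3 < d 4 := hd (by decide)
  intro n θ p hθ hdom hne
  refine leD_31_of_family d v ε family04112130 family04112130_search family04112130_arr family04112130_cover hd.monotone ?_ ?_ ?_ ?_ n θ p hθ hdom hne
  · intro e he r hr
    simp only [family04112130, List.mem_cons, List.not_mem_nil, or_false] at he
    rcases he with rfl | rfl | rfl | rfl | rfl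
    · simp only [entry04112130_0, List.mem_cons, List.not_mem_nil, or_false] at hr
      rcases hr with rfl | rfl | rfl <;> dsimp only <;> omega
    · simp only [entry04112130_1, List.mem_cons, List.not_mem_nil, or_false] at hr
      rcases hr with rfl | rfl <;> dsimp only <;> omega
    · simp [entry04112130_2] at hr
    · simp only [entry04112130_3, List.mem_cons, List.not_mem_nil, or_false] at hr
      subst hr
      dsimp only; omega
    · simp only [entry04112130_4, List.mem_cons, List.not_mem_nil, or_false] at hr
      rcases hr with rfl | rfl | rfl | rfl | rfl <;> dsimp only <;> omega
  · intro e he r hr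
    simp only [family04112130, List.mem_cons, List.not_mem_nil, or_false] at he
    rcases he with rfl | rfl | rfl | rfl | rfl
    · simp only [entry04112130_0, List.mem_cons, List.not_mem_nil, or_false] at hr
      rcases hr with rfl | rfl <;> dsimp only <;> omega
    · simp only [entry04112130_1, List.mem_cons, List.not_mem_nil, or_false] at hr
      rcases hr with rfl | rfl | rfl <;> dsimp only <;> omega
    · simp only [entry04112130_2, List.mem_cons, List.not_mem_nil, or_false] at hr
      subst hr
      dsimp only; omega
    · simp only [entry04112130_3, List.mem_cons, List.not_mem_nil, or_false] at hr
      subst hr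
      dsimp only; omega
    · simp only [entry04112130_4, List.mem_cons, List.not_mem_nil, or_false] at hr
      rcases hr with rfl | rfl | rfl | rfl <;> dsimp only <;> omega
  · intro e he r hr
    simp only [family04112130, List.mem_cons, List.not_mem_nil, or_false] at he
    rcases he with rfl | rfl | rfl | rfl | rfl
    · simp only [entry04112130_0, List.mem_cons, List.not_mem_nil, or_false] at hr
      rcases hr with rfl | rfl | rfl <;> unfold s3 <;> dsimp only <;> omega
    · simp only [entry04112130_1, List.mem_cons, List.not_mem_nil, or_false] at hr
      rcases hr with rfl | rfl <;> unfold s3 <;> dsimp only <;> omega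
    · simp only [entry04112130_2, List.mem_cons, List.not_mem_nil, or_false] at hr
      rcases hr with rfl | rfl | rfl | rfl <;> unfold s3 <;> dsimp only <;> omega
    · simp only [entry04112130_3, List.mem_cons, List.not_mem_nil, or_false] at hr
      subst hr
      unfold s3; dsimp only; omega
    · simp only [entry04112130_4, List.mem_cons, List.not_mem_nil, or_false] at hr
      rcases hr with rfl | rfl | rfl | rfl | rfl | rfl | rfl | rfl | rfl | rfl <;> unfold s3 <;> dsimp only <;> omega
  · intro e he
    simp only [family04112130, List.mem_cons, List.not_mem_nil, or_false] at he
    rcases he with rfl | rfl | rfl | rfl | rfl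
    · simp only [entry04112130_0, List.isChain_cons_cons, symSlope_mk]
      refine ⟨?_, ?_, ?_, List.isChain_singleton _⟩ <;> omega
    · simp only [entry04112130_1, List.isChain_cons_cons, symSlope_mk]
      refine ⟨?_, ?_, List.isChain_singleton _⟩ <;> omega
    · simp only [entry04112130_2, List.isChain_cons_cons, symSlope_mk]
      refine ⟨?_, ?_, List.isChain_singleton _⟩ <;> omega
    · simp only [entry04112130_3, List.isChain_cons_cons, symSlope_mk]
      refine ⟨?_, ?_, List.isChain_singleton _⟩ <;> omega
    · simp only [entry04112130_4, List.isChain_cons_cons, symSlope_mk]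
      refine ⟨?_, ?_, ?_, ?_, List.isChain_singleton _⟩ <;> omega

end ThreeFive

end Summit.ValiantsHypothesis.ValiantsHypothesis.Theorems.KPlusLogSqLaw
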